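import Summits.QuantumFields.YangMills.Theorems.BalabanUVNodesN27AtAdmReadingOfRecord13CoPHHolderProducers
import Summits.QuantumFields.YangMills.Theorems.BalabanUVNodesN27ReadOutAtOfProbes

/-!
# BalabanUVNodes ∕ N27 = binder B5 AT THE RECORD — THE K3⁷ REDUCTION AT node00-def-W1's ADMISSIBLE `CoPH` READING, R-β, WITH **EVERY** K4 RATE SLOT IN A PRODUCER's LANDED
# CURRENCY: (R) `…N27AtAdmReadingOfRecord13CoPHHolderProducers` (dag-n27-c g10, p582115) with its ONE remaining bare binder — the (D4) read-out `hD4 : … ReadOutAt …` — SWAPPED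
# for per-tuple, per-run-length PROBE-RECIPE data (`…N27ReadOutAtOfProbes.readOutAt_u3OfRecord₁₃_of_probes`, this seat's p584096): `RepresentsA∕B` of the datum's β-functions by the
# recipe, slice analyticity on `Window θ.γ`, the locality sum with `8K∕α² ≤ cr`, non-empty probe sets, and the letter signs `((li F θ).analytic θ.γ).Signs`
# (cell `pub-ymgap`, HUMAN RULING D-0062 Track A; director-ym №197 ∕ HUMAN RULING D-0149; width seat `pub-ymgap-dag-n27-w1` gen 0, W-SEAT START LIST §N27 ITEM 1 completed: the (D4) slot
# in producer currency; K3⁷ `SpineGivenEndpointR13SepCoPH` = stmt-QuantumFields-20544, `--kind proof --supports 20544 --as helper`; COUNT-NEUTRAL; THEOREMS ONLY, 0 `def`, 0 `sorry`;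
# `N`-generic, regime-generic, NO Theses import — the item-facing face is leaf F′ `…N27SpineGivenEndpointR13SepCoPHHolderProducersProbes`)

WHAT IS KERNEL-CHECKED ([bookkeeping]; ONE theorem): ★★ `spine_rec13CCoPHOn_at_readingAdm₁₃CoPH_holder_of_uniformLeaves_c2Bg_thm33Letters_probes` — (R)'s regime theorem VERBATIM
(same section variables §0, same `Admissible` variables, same binders `h14 h18 hjunk hnum hstrip h20 h21 hx h19 hne2`) with `hD4` REPLACED by `hsg` (the analytic letter block's signs,
node00-def-W1 `LetterInputs.signs_analytic` shape) and `hprobes` (∃ probe structure `PB` on the level-`k` carriers of W1's `u3Objects θ.γ` with the §2 clauses of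
`readOutAt_u3OfRecord₁₃_of_probes` at `D := datumOfRecord₁₃CoPH F N θ hP`); proof = (R) at `hD4 :=` one application of `readOutAt_u3OfRecord₁₃_of_probes` per `(F, θ, hP, k)`.

HONEST FRAMING.  COMPOSITE-node bookkeeping BY NAME; no estimate; EVERY displayed antecedent is a HYPOTHESIS inhabited for no family today (END-B uniform leaves; the MODEL-level
reading equation `hne2`; Thm 3.3 ∕ dictionary ∕ letters ∕ `LeafH3sup`; W1's table letters and numerals; the N18 closed-form bound; THE PROBE DATA — that W1's level functionals
`functionalC (S F θ k)` read Bałaban's β of record `betaOfMerged …` through a finite probe recipe of (1.20)–(1.22) type with analytic charts and a summable locality constant is NOT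
proved here or anywhere; the K5 stubs; the N19′ edge at exponent β); β a LETTER in `[0, 1]`; NE3 at exponent β and every other estimate NOT PROVED; nothing of Bałaban's asserted
or instantiated; no `Provisos₁₃CoPH` inhabitant claimed (K0⁷ open); N14 ∕ N15 ∕ N16 ∕ N17 ∕ N18 ∕ N22 ∕ N27 NOT discharged; K3⁷ NOT claimed; counts UNMOVED (typed 28∕28 · discharged
5∕27, A 5∕28); one finite four-torus programme at fixed `ε` — R4 closes the conditional rung `BalabanLadder.UV` only: NOT ℝ⁴, NOT infinite volume, NOT OS, NOT a mass gap, NOT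
Clay.  No decl below carries a cite tag.
-/

set_option autoImplicit false

namespace Summit.QuantumFields.YangMills.Theorems.BalabanUVNodesN27SpineRecord

open Set Metric
open scoped Matrix.Norms.L2Operator

open Literature.MathematicalPhysics.QuantumFieldTheory.Balaban1983to89
open Literature.MathematicalPhysics.QuantumFieldTheory.Balaban1983to89.T4Continuum
open Literature.MathematicalPhysics.QuantumFieldTheory.Balaban1983to89.T4OutputRate (Carriers Functional NE5 DecayBound Window)
open Literature.MathematicalPhysics.QuantumFieldTheory.Balaban1983to89.TreeLengthTorus (TDom tsys torusTreeLen)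
open Literature.MathematicalPhysics.QuantumFieldTheory.Balaban1983to89.T4InputCauchyRateData (StepModel)
open Literature.MathematicalPhysics.QuantumFieldTheory.Balaban1983to89.B13Resummation (locE)
open Literature.MathematicalPhysics.QuantumFieldTheory.Balaban1983to89.TreeLengthTorusGeometry (TTouch)
open Literature.MathematicalPhysics.QuantumFieldTheory.Balaban1983to89.B12TreeDecay (K₀)
open Summit.QuantumFields.BalabanUV.T4Continuum.Spine.NE5
open YMDAG.N18.HLayer
open YMDAG.N18.W1Reading (s_N18_rRec₁₃CoPH_readingAdm_of_envelope_bound238_pin n18At_u3OfRecord₁₃_readingAdm_iff)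
open T4ContinuumYM4Torus (ForSmallCouplings)
open Summit.QuantumFields.BalabanUV.T4Continuum.Spine
open YMDAG.UVSplit
open Node00 (Stage13HParams datumOfRecord₁₃CoPH IsRecordOfRecord₁₃CCoPH IsDatumOfRecord₁₃CCoPH NE3Letters₁₁ NE2Objects₁₁ ne3ConstLayerOfRecord₁₁ MatA ιSU prependCoupling)
open Node00.Sect2 (domCount domSys CPair ofBackgroundC)
open Node00.W1 (ReadingData LevelPairing LetterInputs ClusterTower pairOfRecord functionalC termC box SpRestr AdmBg)
open YMDAG.N22 (s_N22_readingOfRecord₁₃CoPH_ofRecordAdm_of_s_N18_analytic s_N22_readingOfRecord₁₃CoPHOn_ofRecordAdm_of_s_N18_stripBound)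
open B7Prop1Explicit B7Prop2Explicit
open B8Ineq132 (InAk covDerivFwd)
open B8LeafModelZd (ZdIdx)
open B8SockLettersRD (SockLettersRD)
open B7Eq78Linearization (zdBlocking QprimeIter)
open B8Eq119TwistedAxial (bgT)
open B8Eq140Level (SideTouches)
open B8Eq138LandauZd (covLap QT)
open B8Eq1117Concrete (XSpace)
open B8Prop5ContractionKLevel (Bd2)
open B8LambdaSpaceKLevel (wt)
open B9SupplySockB9P3ZdLetters (OpsZd)
open B9SupplySockB9P3ZdAt (DictAt Prop6At InvAt CurvAt LandauAt AvgAt HolderAt)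
open Node00 (ne3NperOfRecord₁₁ ne3DomOfRecord₁₁)
open Summit.QuantumFields.BalabanUV.T4Continuum.NE3.LeafIndexSockets (LeafH3sup)
open Summit.QuantumFields.BalabanUV.T4Continuum.NE1p.DressedRoot (UniformConstants BookingLeaves)
open YMDAG.N14 (n14At_of_uniformLeaves s_N14_rRec₁₃CoPHOn_of_uniformLeaves)
open Summit.QuantumFields.YangMills.BalabanUVNodes.N15.AtKeyedHome (neZero_blockFactor)
open Summit.QuantumFields.YangMills.BalabanUVNodes.N15.UnitLayerBg (c2BgObjects)
open Summit.QuantumFields.YangMills.BalabanUVNodes.N15.AtReadingOfRecord13CoPH (s_N15_readingOfRecord₁₃CoPH_of_c2Bg_family s_N15_readingOfRecord₁₃CoPHOn_of_c2Bg_family)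
open Summit.QuantumFields.YangMills.BalabanUVNodes.SpineRatesHolder (RatesHolderAt)
open Summit.QuantumFields.YangMills.BalabanUVNodes.N16OfThm33LettersAllTorusAtRecord13CoPH (exists_letters_s_N16Holder_readingOfRecord₁₃CoPHOn_of_thm33Letters_allTorus)
open Literature.MathematicalPhysics.QuantumFieldTheory.Balaban1983to89.T4BetaReadOut (RepresentsA RepresentsB)
open Literature.MathematicalPhysics.QuantumFieldTheory.Balaban1983to89.T4BetaReadOutLipschitz (Probes)
open Summit.QuantumFields.YangMills.BalabanUVNodes.N27ReadOutAtOfProbes (readOutAt_u3OfRecord₁₃_of_probes)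

variable {N : ℕ} [NeZero N] (cr : SpineReading₁₃CoPH N) {β : ℝ} (hβ0 : 0 ≤ β) (hβ1 : β ≤ 1)

/-! ## §0 The N16 supplier's inputs at exponent `β` (dag-n16-e 40ᴮ §2, VERBATIM; as in (Q) §3) -/

variable {g₃ : T4Family → ℝ} (hg₃ : ∀ F, 0 < g₃ F)
  (hD : ∀ F : T4Family, letI : CStarAlgebra (Matrix (Fin N) (Fin N) ℂ) := {}
      ∃ (len : Site 4 → ℝ) (I : Type) (geo : I → B9.Geometry) (bg : I → B9.Backgrounds) (GA Gp : ∀ i, B9.KernelFamily (geo i) (bg i)) (c35 : ℝ)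
        (mem : ℝ → ZdIdx 4 F.L → ℕ → I)
        (ιCfg : ∀ (M : ℝ) (i : ZdIdx 4 F.L) (m : ℕ) (U₀ : Site 4 → Fin 4 → (Matrix (Fin N) (Fin N) ℂ)ˣ), (∀ x κ, U₀ x κ ∈ unitaryUnits (Matrix (Fin N) (Fin N) ℂ)) → (bg (mem M i m)).Cfg)
        (ιLoc : ∀ (M : ℝ) (i : ZdIdx 4 F.L) (m : ℕ), (Site 4 → Fin 4 → Matrix (Fin N) (Fin N) ℂ) → (geo (mem M i m)).Loc)
        (ops : ℝ → ZdIdx 4 F.L → ℕ → OpsZd 4 (Matrix (Fin N) (Fin N) ℂ)) (c₆ K₆ M₃ a₃ c69 q CH B₀'H B₂' BG BR cL : ℝ),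
        (∀ v : Site 4, 0 < len v → 1 ≤ len v) ∧ (∀ μ : Fin 4, len (e μ) = 1) ∧
        B9.Thm33Printed c35 geo bg Gp GA ∧
        0 < c₆ ∧ 0 < K₆ ∧ 0 < a₃ ∧ 0 ≤ c69 ∧ 0 ≤ q ∧ 0 < B₀'H ∧ 0 ≤ B₂' ∧ 0 ≤ BG ∧ 0 ≤ BR ∧ 0 < cL ∧
        (∀ (M : ℝ) (i : {i : ZdIdx 4 F.L // (∀ j, i.Ω j = Set.univ) ∧ (∀ m j, i.Λs m j = {_y | j = m}) ∧ (∀ m j, i.Λb m j = {_c | j = m}) ∧ i.η = ((F.L : ℝ)⁻¹) ^ i.k}) (m : ℕ), DictAt geo bg GA F.L mem ιCfg ιLoc ops M i.1 m) ∧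
        (∀ (M : ℝ) (i : {i : ZdIdx 4 F.L // (∀ j, i.Ω j = Set.univ) ∧ (∀ m j, i.Λs m j = {_y | j = m}) ∧ (∀ m j, i.Λb m j = {_c | j = m}) ∧ i.η = ((F.L : ℝ)⁻¹) ^ i.k}) (m : ℕ), M₃ ≤ M → Prop6At bg F.L mem ιCfg c35 c₆ K₆ M i.1 m) ∧
        (∀ (M : ℝ) (i : {i : ZdIdx 4 F.L // (∀ j, i.Ω j = Set.univ) ∧ (∀ m j, i.Λs m j = {_y | j = m}) ∧ (∀ m j, i.Λb m j = {_c | j = m}) ∧ i.η = ((F.L : ℝ)⁻¹) ^ i.k}) (m : ℕ), M₃ ≤ M → InvAt bg F.L mem ιCfg ops c35 a₃ M i.1 m) ∧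
        (∀ (M : ℝ) (i : {i : ZdIdx 4 F.L // (∀ j, i.Ω j = Set.univ) ∧ (∀ m j, i.Λs m j = {_y | j = m}) ∧ (∀ m j, i.Λb m j = {_c | j = m}) ∧ i.η = ((F.L : ℝ)⁻¹) ^ i.k}) (m : ℕ), M₃ ≤ M → CurvAt bg F.L mem ιCfg ops c35 a₃ c69 M i.1 m) ∧
        (∀ (M : ℝ) (i : {i : ZdIdx 4 F.L // (∀ j, i.Ω j = Set.univ) ∧ (∀ m j, i.Λs m j = {_y | j = m}) ∧ (∀ m j, i.Λb m j = {_c | j = m}) ∧ i.η = ((F.L : ℝ)⁻¹) ^ i.k}) (m : ℕ), M₃ ≤ M → LandauAt bg F.L mem ιCfg ops c35 a₃ M i.1 m) ∧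
        (∀ (M : ℝ) (i : {i : ZdIdx 4 F.L // (∀ j, i.Ω j = Set.univ) ∧ (∀ m j, i.Λs m j = {_y | j = m}) ∧ (∀ m j, i.Λb m j = {_c | j = m}) ∧ i.η = ((F.L : ℝ)⁻¹) ^ i.k}) (m : ℕ), AvgAt F.L ops q M i.1 m) ∧
        (∀ (M : ℝ) (i : {i : ZdIdx 4 F.L // (∀ j, i.Ω j = Set.univ) ∧ (∀ m j, i.Λs m j = {_y | j = m}) ∧ (∀ m j, i.Λb m j = {_c | j = m}) ∧ i.η = ((F.L : ℝ)⁻¹) ^ i.k}) (m : ℕ), HolderAt geo bg GA F.L mem ιCfg ops β len CH M i.1 m) ∧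
        (∀ i : {i : ZdIdx 4 F.L // (∀ j, i.Ω j = Set.univ) ∧ (∀ m j, i.Λs m j = {_y | j = m}) ∧ (∀ m j, i.Λb m j = {_c | j = m}) ∧ i.η = ((F.L : ℝ)⁻¹) ^ i.k}, SockLettersRD (𝔸 := Matrix (Fin N) (Fin N) ℂ) F.L BG BR B₀'H B₂' cL i.1.η i.1.k i.1.Ω i.1.Λs) ∧
        (∀ i : {i : ZdIdx 4 F.L // (∀ j, i.Ω j = Set.univ) ∧ (∀ m j, i.Λs m j = {_y | j = m}) ∧ (∀ m j, i.Λb m j = {_c | j = m}) ∧ i.η = ((F.L : ℝ)⁻¹) ^ i.k}, ∀ α₀ : ℝ, 0 < α₀ → α₀ ≤ cL → ∀ U₀ : Site 4 → Fin 4 → (Matrix (Fin N) (Fin N) ℂ)ˣ, (∀ x κ, U₀ x κ ∈ unitaryUnits (Matrix (Fin N) (Fin N) ℂ)) →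
          InAk F.L i.1.k i.1.η α₀ i.1.Ω U₀ →
          ∃ (g Δ : (Site 4 → Matrix (Fin N) (Fin N) ℂ) →ₗ[ℂ] (Site 4 → Matrix (Fin N) (Fin N) ℂ)) (q : (Site 4 → Matrix (Fin N) (Fin N) ℂ) →ₗ[ℂ] (ℕ → Site 4 → Matrix (Fin N) (Fin N) ℂ))
            (qs : (ℕ → Site 4 → Matrix (Fin N) (Fin N) ℂ) →ₗ[ℂ] (Site 4 → Matrix (Fin N) (Fin N) ℂ)) (Aw c : (ℕ → Site 4 → Matrix (Fin N) (Fin N) ℂ) →ₗ[ℂ] (ℕ → Site 4 → Matrix (Fin N) (Fin N) ℂ))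
            (H' : XSpace 4 i.1.k (Matrix (Fin N) (Fin N) ℂ) →ₗ[ℂ] (Site 4 → Matrix (Fin N) (Fin N) ℂ)),
            (∀ x : Site 4 → Matrix (Fin N) (Fin N) ℂ, (∃ C : ℝ, ∀ y, ‖x y‖ ≤ C) → g (Δ x + qs (Aw (q x))) = x) ∧ (∀ φ, qs (c (q (g (g (qs φ))))) = qs φ) ∧
            (∀ (f : Site 4 → Matrix (Fin N) (Fin N) ℂ), ∀ x ∈ i.1.Ω 0, Δ f x = covLap i.1.η U₀ ((i.1.Ω 0).indicator f) x) ∧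
            (∀ (μ : ℕ → Site 4 → Matrix (Fin N) (Fin N) ℂ), ∀ x ∈ i.1.Ω 0, qs μ x = QT F.L i.1.k (i.1.Λs i.1.k) U₀ μ x) ∧
            (∀ (f : Site 4 → Matrix (Fin N) (Fin N) ℂ) (n : ℕ), n ≤ i.1.k → ∀ y ∈ i.1.Λs i.1.k n, q f n y = QprimeIter (zdBlocking 4 F.L) (bgT F.L U₀) n f y) ∧
            (∀ (f : Site 4 → Matrix (Fin N) (Fin N) ℂ) (n : ℕ) (y : Site 4), ¬ (n ≤ i.1.k ∧ y ∈ i.1.Λs i.1.k n) → q f n y = 0) ∧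
            (∀ (X : XSpace 4 i.1.k (Matrix (Fin N) (Fin N) ℂ)) (x : Site 4), ‖H' X x‖ ≤ B₀'H * ‖X‖) ∧
            (∀ n, n ≤ i.1.k → ∀ (X : XSpace 4 i.1.k (Matrix (Fin N) (Fin N) ℂ)), ∀ p ∈ {b : Site 4 × Fin 4 | SideTouches (i.1.Ω n) b.1 b.2},
              wt F.L i.1.η n * ‖covDerivFwd i.1.η U₀ p.2 (H' X) p.1‖ ≤ B₀'H * ‖X‖) ∧
            (∀ X : XSpace 4 i.1.k (Matrix (Fin N) (Fin N) ℂ), Bd2 F.L i.1.η i.1.k i.1.Ω (covLap i.1.η U₀ (H' X)) (B₂' * ‖X‖)) ∧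
            (∀ (Y : XSpace 4 i.1.k (Matrix (Fin N) (Fin N) ℂ)) (n : ℕ) (hn : n ≤ i.1.k) (y : Site 4), y ∈ i.1.Λs i.1.k n →
              QprimeIter (zdBlocking 4 F.L) (bgT F.L U₀) n (H' Y) y = Y (⟨n, Nat.lt_succ_of_le hn⟩, y)) ∧
            (∀ (f : Site 4 → Matrix (Fin N) (Fin N) ℂ) (r : ℝ), 0 ≤ r → Bd2 F.L i.1.η i.1.k i.1.Ω f r →
              (∀ x, ‖g f x‖ ≤ BG * r) ∧ ∀ n, n ≤ i.1.k → ∀ p ∈ {b : Site 4 × Fin 4 | SideTouches (i.1.Ω n) b.1 b.2},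
                wt F.L i.1.η n * ‖covDerivFwd i.1.η U₀ p.2 (g f) p.1‖ ≤ BG * r) ∧
            (∀ (f : Site 4 → Matrix (Fin N) (Fin N) ℂ) (r : ℝ), 0 ≤ r → Bd2 F.L i.1.η i.1.k i.1.Ω f r → Bd2 F.L i.1.η i.1.k i.1.Ω (f - g (qs (c (q (g f))))) (BR * r))))
  (h7 : ∀ F : T4Family, ∃ C ε₀ : ℝ, 0 ≤ C ∧ 0 < ε₀ ∧ ∀ ε : ℝ, 0 < ε → ε ≤ ε₀ →
      LeafH3sup 4 F.L (ne3NperOfRecord₁₁ F 0 0) ε (C * ε) (C * ε) (ne3DomOfRecord₁₁ F N 0 0))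

include hβ0 hβ1 hg₃ hD h7

/-! ## The ADMISSIBLE reading of record (node00-def-W1 `ReadingData.ofRecordAdm`), the residual data `ne2`, `ne1` -/

section Admissible

variable
  (S : (F : T4Family) → (θ : Stage13HParams F N) → (k : ℕ) → ClusterTower (F.P k) (MatA N) θ.τ9.M)
  (sp : (F : T4Family) → (θ : Stage13HParams F N) → (k j : ℕ) → (domSys (F.P k) θ.τ9.M j).Dom → Set (CPair (F.P k) (MatA N)))
  (gauge : (F : T4Family) → (θ : Stage13HParams F N) → (k : ℕ) → GaugeField (F.P k) 0 (Node00.SU N) → GaugeField (F.P k) 0 (Node00.SU N) → ℝ)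
  (hg : ∀ (F : T4Family) (θ : Stage13HParams F N) (k : ℕ) (U U' : GaugeField (F.P k) 0 (Node00.SU N)), 0 ≤ gauge F θ k U U')
  (T₀ : (F : T4Family) → (θ : Stage13HParams F N) → (k : ℕ) → GaugeField (F.P (k + 1)) 0 (Node00.SU N) → GaugeField (F.P k) 0 (Node00.SU N))
  (hT₀ : ∀ (F : T4Family) (θ : Stage13HParams F N) (k : ℕ) (U : GaugeField (F.P (k + 1)) 0 (Node00.SU N)),
    (∀ (j : ℕ) (Y : (domSys (F.P (k + 1)) θ.τ9.M j).Dom), ofBackgroundC (ιSU N) U ∈ sp F θ (k + 1) j Y) →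
      ∀ (j : ℕ) (X : (domSys (F.P k) θ.τ9.M j).Dom), ofBackgroundC (ιSU N) (T₀ F θ k U) ∈ sp F θ k j X)
  (li : (F : T4Family) → Stage13HParams F N → LetterInputs)
  (ne2 : (F : T4Family) → Stage13HParams F N → (ℕ → ℝ) → List (ULoop F) → ℕ → NE2Objects₁₁)
  (ne1 : (F : T4Family) → Stage13HParams F N → (ℕ → ℝ) → List (ULoop F) → NE1pCarriers)

/-- ★★ **N27 = B5 AT THE REGIME RECORD CLASS, ANY `Rg`, AT THE ADMISSIBLE READING — EVERY K4 RATE SLOT, (D4) INCLUDED, IN A PRODUCER's LANDED CURRENCY; NODE N16 IN ITS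
CURRENCY OF RECORD R-β** ((R) with `hD4 ↦ (hsg, hprobes)`): N14 ⟸ END-B uniform leaves, N15 ⟸ `hne2` onto `c2BgObjects …` (U-E), N16 AT EXPONENT `β` ⟸ §0 (40ᴮ §2), N17 eliminated,
N18 in CLOSED FORM at θ, N22 ⟸ N18 (8a″ STRIP), **(D4) ⟸ PROBE RECIPES on W1's level carriers** (`readOutAt_u3OfRecord₁₃_of_probes`: box clause free, `ReadBoundedOn`∕`ReadCovariantOn`
discharged by the recipe theorems at `8K∕α² ≤ cr`), K5 side, the N19′ edge reading `RatesHolderAt … β` ∀ ℓ₃.  At `N = 2`, `Rg :=` the item's guard, THE ITEM (leaf F′).  Every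
displayed antecedent is a HYPOTHESIS (0∕1 today); NE3 at exponent β NOT PROVED. [bookkeeping] -/
theorem spine_rec13CCoPHOn_at_readingAdm₁₃CoPH_holder_of_uniformLeaves_c2Bg_thm33Letters_probes (Rg : (F : T4Family) → Stage13HParams F N → Prop) {b aS : ℝ} (hb : 0 < b) (haS : 0 < aS) {c35 : ℝ} (hc35 : 0 < c35) (α α' : Fin 4) (p : ℝ)
    (h14 : ∀ (F : T4Family) (θ : Stage13HParams F N), θ.Provisos₁₃CoPH F N → Rg F θ → θ.Admissible F N → ∀ (g₀ : ℕ → ℝ) (os : List (ULoop F)),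
      ∃ U : UniformConstants, U.Λ = (ne1 F θ g₀ os).Λ ∧ ∀ p K, Nonempty (BookingLeaves U ((ne1 F θ g₀ os).𝒯.B p K) ((ne1 F θ g₀ os).𝒯.T p K)))
    (h18 : ∀ (F : T4Family) (θ : Stage13HParams F N), θ.Provisos₁₃CoPH F N → Rg F θ → θ.Admissible F N → ∀ (k : ℕ) (b : ℝ), 0 < b → b ≤ θ.γ →
      ∀ g ∈ Window θ.γ,
        ∀ (U : {U : GaugeField (F.P (k + 1)) 0 (Node00.SU N) //
            ∀ (j : ℕ) (Y : (domSys (F.P (k + 1)) θ.τ9.M j).Dom), ofBackgroundC (ιSU N) U ∈ sp F θ (k + 1) j Y})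
          (X : Node00.W1.Dom (F.P k) θ.τ9.M),
        |(functionalC (S F θ k) g (ofBackgroundC (ιSU N) (T₀ F θ k U.1)) X).re -
            (functionalC (S F θ (k + 1)) (prependCoupling b g) (ofBackgroundC (ιSU N) U.1) (pairOfRecord F θ.τ9.M k X)).re| ≤
          (li F θ).C₅ * (li F θ).θ₅ ^ X.1 * Real.exp (-((li F θ).κ * (domSys (F.P k) θ.τ9.M X.1).dj X.2)))
    -- N22 ⟸ N18 (dag-n22-e module 8a″, STRIP currency on the reading's OWN table, NO readings clause): (J), twelve numerals, STRIP-(1.18) — verbatim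
    (hjunk : ∀ (F : T4Family) (θ : Stage13HParams F N), θ.Provisos₁₃CoPH F N → Rg F θ → θ.Admissible F N →
      ∀ (k : ℕ) (X : Node00.W1.Dom (F.P k) θ.τ9.M), k < X.1 → ∀ (g : ℕ → ℝ) (φ : CPair (F.P k) (MatA N)), functionalC (S F θ k) g φ X = 0)
    (hnum : ∀ (F : T4Family) (θ : Stage13HParams F N), θ.Provisos₁₃CoPH F N → Rg F θ → θ.Admissible F N →
      0 < (li F θ).C₀ ∧ 0 < (li F θ).θ₅ ∧ (li F θ).θ₅ < 1 ∧ 0 ≤ (li F θ).C₅ ∧ 2 * (li F θ).C₅ / (1 - (li F θ).θ₅) ≤ (li F θ).C₀ ∧ 0 < (li F θ).A ∧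
        (li F θ).θ₅ ≤ (li F θ).μ ∧ (li F θ).C₀ ≤ 2 * (li F θ).A ∧ 0 < (li F θ).r ∧ 0 < (li F θ).s ∧ (li F θ).s < 1 ∧ 1 ≤ (li F θ).μ)
    (hstrip : ∀ (F : T4Family) (θ : Stage13HParams F N), θ.Provisos₁₃CoPH F N → Rg F θ → θ.Admissible F N → ∀ (k : ℕ),
      ∀ (j : ℕ) (g : ℕ → ℝ), g ∈ Window θ.γ → ∀ (i : ℕ) (Y : (domSys (F.P k) θ.τ9.M j).Dom) (ψ : CPair (F.P k) (MatA N)), ψ ∈ sp F θ k j Y →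
        ∃ (Ec : ℂ → ℂ) (O : Set ℂ), IsOpen O ∧ (∀ t ∈ Ioc (0 : ℝ) θ.γ, closedBall (t : ℂ) (li F θ).r ⊆ O) ∧ DifferentiableOn ℂ Ec O ∧
          (∀ z ∈ O, ‖Ec z‖ ≤ (li F θ).A * Real.exp (-((li F θ).κ * torusTreeLen Y.1))) ∧
          (∀ t ∈ Ioc (0 : ℝ) θ.γ, Ec t = termC (S F θ k) j Y (Function.update g i t) ψ))
    -- (D4) ⟸ PROBE RECIPES (this seat's `…N27ReadOutAtOfProbes`): the analytic letter block's signs and per-tuple, per-run-length probe data on W1's level carriers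
    (hsg : ∀ (F : T4Family) (θ : Stage13HParams F N), θ.Provisos₁₃CoPH F N → Rg F θ → θ.Admissible F N → ((li F θ).analytic θ.γ).Signs)
    (hprobes : ∀ (F : T4Family) (θ : Stage13HParams F N) (hP : θ.Provisos₁₃CoPH F N), Rg F θ → θ.Admissible F N → ∀ k : ℕ,
      ∃ (V : Type) (_ : NormedAddCommGroup V) (_ : NormedSpace ℂ V) (ι : Type)
        (PB : Probes (((ReadingData.ofRecordAdm F θ.τ9.M N (S F θ) (sp F θ) (gauge F θ) (hg F θ) (T₀ F θ) (hT₀ F θ) (li F θ)).u3Objects θ.γ).levelCarriers k)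
          (((ReadingData.ofRecordAdm F θ.τ9.M N (S F θ) (sp F θ) (gauge F θ) (hg F θ) (T₀ F θ) (hT₀ F θ) (li F θ)).u3Objects θ.γ).levelCarriers k).BgB V ι) (αr K : ℝ),
        RepresentsA (((ReadingData.ofRecordAdm F θ.τ9.M N (S F θ) (sp F θ) (gauge F θ) (hg F θ) (T₀ F θ) (hT₀ F θ) (li F θ)).u3Objects θ.γ).EA k) PB.transportTo.recipe θ.γ
          (datumOfRecord₁₃CoPH F N θ hP).βfun ∧
        RepresentsB (((ReadingData.ofRecordAdm F θ.τ9.M N (S F θ) (sp F θ) (gauge F θ) (hg F θ) (T₀ F θ) (hT₀ F θ) (li F θ)).u3Objects θ.γ).EB k) PB.recipe θ.γ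
          (datumOfRecord₁₃CoPH F N θ hP).βfun ∧
        (∀ g ∈ Window θ.γ, ((ReadingData.ofRecordAdm F θ.τ9.M N (S F θ) (sp F θ) (gauge F θ) (hg F θ) (T₀ F θ) (hT₀ F θ) (li F θ)).u3Objects θ.γ).EA k g ∈ PB.transportTo.Analytic αr) ∧
        (∀ b' : ℝ, 0 < b' → b' ≤ θ.γ → ∀ g ∈ Window θ.γ,
          ((ReadingData.ofRecordAdm F θ.τ9.M N (S F θ) (sp F θ) (gauge F θ) (hg F θ) (T₀ F θ) (hT₀ F θ) (li F θ)).u3Objects θ.γ).EB k b' g ∈ PB.Analytic αr) ∧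
        0 < αr ∧ PB.LocalitySum (li F θ).κ K ∧ (∀ j, (PB.idx j).Nonempty) ∧ 8 * K / αr ^ 2 ≤ (li F θ).cr)
    (h20 : S_N20 (SRec₁₃CoPHOn cr Rg)) (h21 : S_N21 (SRec₁₃CoPHOn cr Rg))
    (hx : ∀ (F : T4Family) (θ : Stage13HParams F N) (hP : θ.Provisos₁₃CoPH F N), Rg F θ → θ.Admissible F N →
      B16.EndStatementBPrinted (datumOfRecord₁₃CoPH F N θ hP).C → DagBinding.EndpointExistence (datumOfRecord₁₃CoPH F N θ hP).C.toB12 →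
        ForSmallCouplings (datumOfRecord₁₃CoPH F N θ hP) fun g₀ => ∀ os : List (ULoop F),
          0 < (cr F θ hP g₀ os).l₀ ∧ 0 < (cr F θ hP g₀ os).vol ∧
          (∀ (K : ℕ) (t : ℝ), |t| ≤ (cr F θ hP g₀ os).l₀ →
            T4GenFunBounds.schemeZ ((datumOfRecord₁₃CoPH F N θ hP).scheme g₀) os ((cr F θ hP g₀ os).K₀ + K) t =
              ∑ τ ∈ (cr F θ hP g₀ os).T K, (cr F θ hP g₀ os).A K t τ) ∧
          (∀ (K : ℕ) (t : ℝ), |t| ≤ (cr F θ hP g₀ os).l₀ →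
            T4GenFunBounds.schemeZ ((datumOfRecord₁₃CoPH F N θ hP).scheme g₀) os ((cr F θ hP g₀ os).K₀ + K + 1) t =
              ∑ τ ∈ (cr F θ hP g₀ os).T K, (cr F θ hP g₀ os).B K t τ))
    (h19 : ∀ (ℓ₃ : T4Family → NE3Letters₁₁) (F : T4Family) (θ : Stage13HParams F N) (hP : θ.Provisos₁₃CoPH F N), Rg F θ → θ.Admissible F N → ∀ (g₀ : ℕ → ℝ) (os : List (ULoop F)),
      (∀ k : ℕ, RatesHolderAt (datumOfRecord₁₃CoPH F N θ hP) (rateCarriersOfRecord₁₃CoPH (readingOfRecord₁₃CoPH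
        (fun F θ => ReadingData.ofRecordAdm F θ.τ9.M N (S F θ) (sp F θ) (gauge F θ) (hg F θ) (T₀ F θ) (hT₀ F θ) (li F θ)) ℓ₃ ne2 ne1) F θ hP g₀ os k) β) →
        letI := (cr F θ hP g₀ os).dec
        ∃ δ : ℕ → ℝ, NE7.Core (cr F θ hP g₀ os).l₀ (cr F θ hP g₀ os).vol (cr F θ hP g₀ os).T (cr F θ hP g₀ os).Bad
          (fun K t τ => (cr F θ hP g₀ os).A K t τ - (cr F θ hP g₀ os).shA K t τ) (fun K t τ => (cr F θ hP g₀ os).B K t τ - (cr F θ hP g₀ os).shB K t τ) δ ∧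
          Summable δ)
    (hne2 : ∀ (F : T4Family) (θ : Stage13HParams F N), θ.Provisos₁₃CoPH F N → θ.Admissible F N → ∀ (g₀ : ℕ → ℝ) (os : List (ULoop F)) (k : ℕ),
      ne2 F θ g₀ os k = haveI := neZero_blockFactor F; c2BgObjects 3 F.hL b aS α α' c35 p) :
    Spine (N := N) fun F D w => Node00.IsRecordOfRecord₁₃CCoPHOn F N Rg D w :=
  spine_rec13CCoPHOn_at_readingAdm₁₃CoPH_holder_of_uniformLeaves_c2Bg_thm33Letters (cr := cr) hβ0 hβ1 (hg₃ := hg₃) (hD := hD) (h7 := h7) (S := S) (sp := sp)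
    (gauge := gauge) (hg := hg) (T₀ := T₀) (hT₀ := hT₀) (li := li) (ne2 := ne2) (ne1 := ne1) Rg hb haS hc35 α α' p h14 h18 hjunk hnum hstrip
    (fun F θ hP hRg hθ k => by
      obtain ⟨V, _, _, ι, PB, αr, K, hA, hB, hanA, hanB, hα, hK, hne, hcr⟩ := hprobes F θ hP hRg hθ k
      exact readOutAt_u3OfRecord₁₃_of_probes θ.toStage13Params _ (hsg F θ hP hRg hθ) k _ PB hA hB hanA hanB hα hK hne hcr)
    h20 h21 hx h19 hne2

end Admissible

end Summit.QuantumFields.YangMills.Theorems.BalabanUVNodesN27SpineRecord
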